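import Mathlib
import HarnessLib

/-!
# `SymmetryModuliCount.ForcedSymmetry` (crux stmt-NavierStokesRegularity-4052), line
# `recurrent-closing`, stub `stub_rdssClause_congr_ae`: the "rotated discretely self-similar
# a.e." clause passes to a.e.-representatives on the slab `t < 0`

Support file (everything proved, kind = proof) for the lead's skeleton of the line
`recurrent-closing`, stub `stub_rdssClause_congr_ae` (gen 4 reshape of `stub_recurrentClosing`).

Type-I slab profiles are only determined a.e. on the open slab `S := (-∞, 0) × ℝ³`; the line
replaces a profile `u` by an a.e.-representative `v` and must carry over the clause
"`u` is invariant a.e. on `S` under the parabolic similarity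
`Φ(t, x) = (l² t + τ, l • R x + ξ)` (`l > 1`, `R` a linear isometry, `τ ≤ 0`) composed with
`l • R⁻¹` on values".

Proof.  Keep the same data `(l, R, ξ, τ)` for `v`.  The map `Φ` is the product of the affine maps
`t ↦ l² t + τ` of `ℝ` and `x ↦ l • R x + ξ` of `ℝ³`; both are quasi-measure-preserving for
Lebesgue measure (`Real.map_volume_mul_left`, `Measure.quasiMeasurePreserving_smul`,
`LinearIsometryEquiv.measurePreserving`, `measurePreserving_add_right`), hence so is `Φ` for the
product measure (`MeasureTheory.QuasiMeasurePreserving.prodMap`, `Measure.volume_eq_prod`).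
Therefore the a.e. statement "`w ∈ S → u w = v w`" pulls back along `Φ`
(`QuasiMeasurePreserving.ae`), and since `Φ` maps `S` into `S` (`l² t + τ < 0` for `t < 0`,
`τ ≤ 0`) we get `u ∘ Φ = v ∘ Φ` a.e. on `S`.
Combining with `u = v` a.e. on `S` and the clause for `u` gives the clause for `v`:
`l • R⁻¹ (v (Φ z)) = l • R⁻¹ (u (Φ z)) = u z = v z` for a.e. `z ∈ S`.

Pure Mathlib measure theory; no named facts are used.
-/

noncomputable section

-- the summit and its single problem share the name (D-0017 nested layout)
set_option linter.dupNamespace false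

open MeasureTheory Set Function

namespace Summit.NavierStokesRegularity.NavierStokesRegularity.Theorems.SymmetryModuliCountForcedSymmetry

/-- The affine time map `t ↦ c t + τ`, `c ≠ 0`, is quasi-measure-preserving for Lebesgue measure
on `ℝ` (its push-forward of `volume` is `|c⁻¹| • volume`). [folklore] -/
theorem quasiMeasurePreserving_const_mul_add {c : ℝ} (hc : c ≠ 0) (τ : ℝ) :
    Measure.QuasiMeasurePreserving (fun t : ℝ => c * t + τ) volume volume := by
  have h1 : Measure.QuasiMeasurePreserving (fun t : ℝ => c * t) volume volume := by
    refine ⟨measurable_const_mul c, ?_⟩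
    rw [Real.map_volume_mul_left hc]
    exact Measure.smul_absolutelyContinuous
  exact (measurePreserving_add_right volume τ).quasiMeasurePreserving.comp h1

/-- The similarity `x ↦ l • R x + ξ` of `ℝ³` (`l ≠ 0`, `R` a linear isometry) is
quasi-measure-preserving for Lebesgue measure (isometries and translations preserve `volume`,
the homothety rescales it by `|l|⁻³`). [folklore] -/
theorem quasiMeasurePreserving_smul_isometry_add {l : ℝ} (hl : l ≠ 0)
    (R : EuclideanSpace ℝ (Fin 3) ≃ₗᵢ[ℝ] EuclideanSpace ℝ (Fin 3)) (ξ : EuclideanSpace ℝ (Fin 3)) :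
    Measure.QuasiMeasurePreserving (fun x : EuclideanSpace ℝ (Fin 3) => l • R x + ξ)
      volume volume :=
  (measurePreserving_add_right volume ξ).quasiMeasurePreserving.comp
    ((Measure.quasiMeasurePreserving_smul volume hl).comp
      R.measurePreserving.quasiMeasurePreserving)

/-- The parabolic similarity `Φ(t, x) = (l² t + τ, l • R x + ξ)` of `ℝ × ℝ³` (`l ≠ 0`) is
quasi-measure-preserving for Lebesgue measure. [folklore] -/
theorem quasiMeasurePreserving_rdssSimilarity {l : ℝ} (hl : l ≠ 0)
    (R : EuclideanSpace ℝ (Fin 3) ≃ₗᵢ[ℝ] EuclideanSpace ℝ (Fin 3)) (ξ : EuclideanSpace ℝ (Fin 3))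
    (τ : ℝ) :
    Measure.QuasiMeasurePreserving
      (fun z : ℝ × EuclideanSpace ℝ (Fin 3) => (l ^ 2 * z.1 + τ, l • R z.2 + ξ)) volume volume := by
  have h := MeasureTheory.QuasiMeasurePreserving.prodMap
    (quasiMeasurePreserving_const_mul_add (pow_ne_zero 2 hl) τ)
    (quasiMeasurePreserving_smul_isometry_add hl R ξ)
  rw [Measure.volume_eq_prod]
  exact h

/-- **Stub `stub_rdssClause_congr_ae`.** If `u = v` a.e. on the slab `S = (-∞, 0) × ℝ³` and `u`
satisfies the "rotated discretely self-similar a.e. on `S`" clause with data `(l, R, ξ, τ)`,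
`l > 1`, `τ ≤ 0`, then `v` satisfies the same clause with the same data: the similarity
`Φ(t, x) = (l² t + τ, l • R x + ξ)` maps `S` into itself and pulls back Lebesgue-null sets to
null sets, so `u ∘ Φ = v ∘ Φ` a.e. on `S`. [folklore] -/
theorem stub_rdssClause_congr_ae :
    ∀ (u v : ℝ → EuclideanSpace ℝ (Fin 3) → EuclideanSpace ℝ (Fin 3)),
      (Function.uncurry u =ᵐ[MeasureTheory.volume.restrict (Set.Iio (0 : ℝ) ×ˢ Set.univ)]
        Function.uncurry v) →
      (∃ l : ℝ, 1 < l ∧ ∃ (R : EuclideanSpace ℝ (Fin 3) ≃ₗᵢ[ℝ] EuclideanSpace ℝ (Fin 3))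
          (ξ : EuclideanSpace ℝ (Fin 3)) (τ : ℝ),
          τ ≤ 0 ∧ (fun z : ℝ × EuclideanSpace ℝ (Fin 3) =>
              l • R.symm (u (l ^ 2 * z.1 + τ) (l • R z.2 + ξ)))
            =ᵐ[MeasureTheory.volume.restrict (Set.Iio (0 : ℝ) ×ˢ Set.univ)]
              (fun z : ℝ × EuclideanSpace ℝ (Fin 3) => u z.1 z.2)) →
      (∃ l : ℝ, 1 < l ∧ ∃ (R : EuclideanSpace ℝ (Fin 3) ≃ₗᵢ[ℝ] EuclideanSpace ℝ (Fin 3))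
          (ξ : EuclideanSpace ℝ (Fin 3)) (τ : ℝ),
          τ ≤ 0 ∧ (fun z : ℝ × EuclideanSpace ℝ (Fin 3) =>
              l • R.symm (v (l ^ 2 * z.1 + τ) (l • R z.2 + ξ)))
            =ᵐ[MeasureTheory.volume.restrict (Set.Iio (0 : ℝ) ×ˢ Set.univ)]
              (fun z : ℝ × EuclideanSpace ℝ (Fin 3) => v z.1 z.2)) := by
  intro u v huv hu
  obtain ⟨l, hl, R, ξ, τ, hτ, hclause⟩ := hu
  refine ⟨l, hl, R, ξ, τ, hτ, ?_⟩
  have hl0 : l ≠ 0 := (zero_lt_one.trans hl).ne'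
  have hS : MeasurableSet (Iio (0 : ℝ) ×ˢ (univ : Set (EuclideanSpace ℝ (Fin 3)))) :=
    measurableSet_Iio.prod MeasurableSet.univ
  -- `u = v` off a Lebesgue-null set of the slab, as an a.e. statement for the full measure
  have hall : ∀ᵐ w ∂(volume : Measure (ℝ × EuclideanSpace ℝ (Fin 3))),
      w ∈ Iio (0 : ℝ) ×ˢ (univ : Set (EuclideanSpace ℝ (Fin 3))) → uncurry u w = uncurry v w :=
    (ae_restrict_iff' hS).1 huv
  -- pull it back along the quasi-measure-preserving similarity `Φ`
  have hcomp : ∀ᵐ z ∂(volume : Measure (ℝ × EuclideanSpace ℝ (Fin 3))),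
      (l ^ 2 * z.1 + τ, l • R z.2 + ξ) ∈ Iio (0 : ℝ) ×ˢ (univ : Set (EuclideanSpace ℝ (Fin 3))) →
        u (l ^ 2 * z.1 + τ) (l • R z.2 + ξ) = v (l ^ 2 * z.1 + τ) (l • R z.2 + ξ) :=
    (quasiMeasurePreserving_rdssSimilarity hl0 R ξ τ).ae hall
  filter_upwards [hclause, ae_restrict_of_ae hcomp, ae_restrict_mem hS, huv] with z hz1 hz2 hz3
    hz4
  -- `Φ` maps the slab into the slab
  have hΦz : (l ^ 2 * z.1 + τ, l • R z.2 + ξ) ∈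
      Iio (0 : ℝ) ×ˢ (univ : Set (EuclideanSpace ℝ (Fin 3))) := by
    refine ⟨?_, mem_univ _⟩
    have hz : z.1 < 0 := hz3.1
    have hneg : l ^ 2 * z.1 < 0 := mul_neg_of_pos_of_neg (by positivity) hz
    show l ^ 2 * z.1 + τ < 0
    linarith
  rw [← hz2 hΦz, hz1]
  exact hz4

end Summit.NavierStokesRegularity.NavierStokesRegularity.Theorems.SymmetryModuliCountForcedSymmetry

end
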